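import Summits.PneNP.PneNP.Theorems.MacroscopicTwinsAbove.Negative.DefectBound

/-!
# `MacroscopicTwinsAbove` (stmt-PneNP-2720, route PneNP/PhaseTwins) — negative side II: load-bearing hypotheses and the shape of a refutation

Standing-adversary (cdisprove) lemmas for `Summit.PneNP.PneNP.Theses.PhaseTwins.MacroscopicTwinsAbove`, continuing
`Negative/DefectBound.lean` (notation `Z`, `lamC`, `HomIndist`, `Witness`, `crux_iff`). The crux is NOT refuted; these
theorems record which hypotheses carry weight and what a refutation would have to be. All variants of the crux are
stated INLINE (no named facts).
* `withoutPosN_trivial`, `withoutPosDelta_trivial`: WITHOUT `0 < n` (resp. `0 < δ`) the crux is trivially true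
  (`n = 0`, resp. `δ = 0` with `G = H`).
* `trivial_without_homIndist`: WITHOUT hom-indistinguishability it is trivially true on two vertices for every `k`
  (`G = ⊥`, `H = K₂`, `δ = ½ log((1+λ)²/(1+2λ))`; `Z_bot`, `Z_top_two`) — the one hypothesis that makes the crux
  non-trivial.
* `false_without_degreeFloor`: WITHOUT `3 ≤ Δ` it is false — at `Δ = 0` the typed threshold has the junk value
  `λ_c(0) = 1` and max-degree-`0` graphs all have `Z = (1+λ)^n`.
* `false_without_threshold_of_densityContinuityBelow`: the all-`λ > 0` form contradicts the route's own support
  `DensityContinuityBelow` (stmt-PneNP-2725: BCKL 2013 Remark 1 + Weitz 2006) at `Δ = 3`, `λ = 1 < 4 = λ_c(3)`.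
* `swapped_of_constantFactorTwins`: the `∀ k ∃ δ` form follows from `ConstantFactorTwinsEverywhere` (stmt-PneNP-2726)
  with `δ := log 2 / n` — the whole content of the crux is that `δ` does not depend on `k`.
* `not_crux_iff_densityContinuityAt`: `¬ crux ↔ ∃ Δ ≥ 3, ∃ λ > λ_c(Δ)`, density continuity at `(Δ, λ)` (`∀ δ > 0 ∃ k`,
  `C^k`-equivalent max-degree-`Δ` graphs have `Z_G ≤ e^{δn} Z_H` — the conclusion shape of stmt-PneNP-2725 at one
  activity, stated inline) — a kill is EXACTLY a density-continuity theorem at one supercritical activity;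
  `densityContinuityAt_of_below`: with stmt-PneNP-2725 the pair (support, crux) is a dichotomy at `λ_c(Δ)` leaving
  only the critical point unclaimed.
Refuter seats cdisprove-stmt-PneNP-2720 (cycle 1, author) and -g2 (cycle 2, re-landing after the gate restart bounced
p74097/p74324), 2026-08-16; commentary in `Summits/PneNP/PneNP/Cruxes/MacroscopicTwinsAbove/Disproof.lean`.
-/

set_option linter.dupNamespace false

namespace Summit.PneNP.PneNP.Theorems.MacroscopicTwinsAbove.Negative

open scoped Classical BigOperators
open Finset

/-! ### Load-bearing hypotheses -/

/-- WITHOUT `0 < n` the crux is TRIVIALLY TRUE (witness `n = 0`, `G = H = ⊥`): `0 < n` is what excludes junk.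
[folklore] -/
theorem withoutPosN_trivial :
    ∀ Δ : ℕ, 3 ≤ Δ → ∀ lam : ℝ, lamC Δ < lam → ∃ δ : ℝ, 0 < δ ∧ ∀ k : ℕ,
      ∃ (n : ℕ) (G H : SimpleGraph (Fin n)), G.maxDegree ≤ Δ ∧ H.maxDegree ≤ Δ ∧ HomIndist k G H ∧
        Real.exp (δ * n) * Z H lam ≤ Z G lam := by
  intro Δ _ lam _
  refine ⟨1, one_pos, fun k => ⟨0, ⊥, ⊥, ?_, ?_, fun m F _ => rfl, ?_⟩⟩
  · simp [SimpleGraph.maxDegree, Finset.univ_eq_empty]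
  · simp [SimpleGraph.maxDegree, Finset.univ_eq_empty]
  · simp

/-- WITHOUT `0 < δ` the crux is TRIVIALLY TRUE as well (witness `δ = 0`, `G = H = ⊥` on one vertex): the two
positivity side conditions `0 < n`, `0 < δ` are exactly what excludes junk witnesses. [folklore] -/
theorem withoutPosDelta_trivial :
    ∀ Δ : ℕ, 3 ≤ Δ → ∀ lam : ℝ, lamC Δ < lam → ∃ δ : ℝ, 0 ≤ δ ∧ ∀ k : ℕ,
      ∃ (n : ℕ) (G H : SimpleGraph (Fin n)), Witness Δ lam δ k n G H := by
  intro Δ _ lam _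
  refine ⟨0, le_rfl, fun k => ⟨1, ⊥, ⊥, one_pos, ?_, ?_, fun m F _ => rfl, ?_⟩⟩
  · simp [SimpleGraph.maxDegree]
  · simp [SimpleGraph.maxDegree]
  · simp

/-- `Z_⊥(λ) = (1+λ)^n` (every vertex set of the edgeless graph is independent). [folklore] -/
theorem Z_bot (n : ℕ) (lam : ℝ) : Z (⊥ : SimpleGraph (Fin n)) lam = (1 + lam) ^ n := by
  unfold Z
  have h1 : ∀ I : Finset (Fin n), (⊥ : SimpleGraph (Fin n)).IsIndepSet (↑I : Set (Fin n)) := fun I => by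
    intro u _ v _ _ h
    exact h
  simp only [h1, if_true]
  have := Fintype.sum_pow_mul_eq_add_pow (Fin n) lam 1
  simp only [one_pow, mul_one, Fintype.card_fin] at this
  rw [this, add_comm]

/-- `Z_{K₂}(λ) = 1 + 2λ`. [folklore] -/
theorem Z_top_two (lam : ℝ) : Z (⊤ : SimpleGraph (Fin 2)) lam = 1 + 2 * lam := by
  unfold Z
  have huniv : (Finset.univ : Finset (Finset (Fin 2))) = {∅, {0}, {1}, {0, 1}} := by decide
  rw [huniv]
  have hind0 : (⊤ : SimpleGraph (Fin 2)).IsIndepSet (↑(∅ : Finset (Fin 2)) : Set (Fin 2)) := by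
    simp [SimpleGraph.isIndepSet_iff]
  have hind1 : ∀ a : Fin 2, (⊤ : SimpleGraph (Fin 2)).IsIndepSet (↑({a} : Finset (Fin 2)) : Set (Fin 2)) := by
    intro a
    simp [SimpleGraph.isIndepSet_iff]
  have hind2 : ¬ (⊤ : SimpleGraph (Fin 2)).IsIndepSet (↑({0, 1} : Finset (Fin 2)) : Set (Fin 2)) := by
    intro h
    have := h (show (0 : Fin 2) ∈ (↑({0, 1} : Finset (Fin 2)) : Set (Fin 2)) by simp)
      (show (1 : Fin 2) ∈ (↑({0, 1} : Finset (Fin 2)) : Set (Fin 2)) by simp) (by decide)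
    exact this (by simp [SimpleGraph.top_adj])
  rw [Finset.sum_insert (by decide), Finset.sum_insert (by decide), Finset.sum_insert (by decide),
    Finset.sum_singleton]
  simp only [hind0, hind1, hind2, if_true, if_false, Finset.card_empty, Finset.card_singleton, pow_zero, pow_one]
  ring

/-- WITHOUT hom-indistinguishability the crux is TRIVIALLY TRUE, uniformly in `k` and already on TWO vertices:
`G = ⊥`, `H = K₂`, `δ = ½ log((1+λ)²/(1+2λ)) > 0` for every `λ > 0` (so in particular for `λ > λ_c(Δ)`).
`HomIndist` is thus the one hypothesis that makes the crux non-trivial (it forces `n > k`, `lt_card_of_witness`).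
[folklore] -/
theorem trivial_without_homIndist :
    ∀ Δ : ℕ, 3 ≤ Δ → ∀ lam : ℝ, 0 < lam → ∃ δ : ℝ, 0 < δ ∧ ∀ k : ℕ,
      ∃ (n : ℕ) (G H : SimpleGraph (Fin n)), 0 < n ∧ G.maxDegree ≤ Δ ∧ H.maxDegree ≤ Δ ∧
        Real.exp (δ * n) * Z H lam ≤ Z G lam := by
  intro Δ hΔ lam hlam
  have hq : 1 < (1 + lam) ^ 2 / (1 + 2 * lam) := by
    rw [one_lt_div (by linarith)]
    nlinarith
  refine ⟨Real.log ((1 + lam) ^ 2 / (1 + 2 * lam)) / 2, div_pos (Real.log_pos hq) two_pos,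
    fun _k => ⟨2, ⊥, ⊤, two_pos, ?_, ?_, ?_⟩⟩
  · refine le_trans (@SimpleGraph.maxDegree_le_of_forall_degree_le (Fin 2) ⊥ _ (_) 0 (fun v => ?_))
      (Nat.zero_le Δ)
    rw [SimpleGraph.degree, Nat.le_zero, Finset.card_eq_zero, ← Finset.subset_empty]
    intro w hw
    rw [SimpleGraph.mem_neighborFinset] at hw
    exact hw.elim
  · -- `K₂` has maximum degree `1 ≤ Δ`
    refine le_trans (@SimpleGraph.maxDegree_le_of_forall_degree_le (Fin 2) ⊤ _ (_) 1 (fun v => ?_))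
      (show 1 ≤ Δ by omega)
    rw [SimpleGraph.degree]
    refine (Finset.card_le_card (t := Finset.univ.erase v) ?_).trans ?_
    · intro w hw
      rw [SimpleGraph.mem_neighborFinset, SimpleGraph.top_adj] at hw
      simp [Ne.symm hw]
    · simp
  · rw [Z_bot, Z_top_two]
    have h2 : Real.log ((1 + lam) ^ 2 / (1 + 2 * lam)) / 2 * ((2 : ℕ) : ℝ) =
        Real.log ((1 + lam) ^ 2 / (1 + 2 * lam)) := by push_cast; ring
    rw [h2, Real.exp_log (by positivity), div_mul_cancel₀ _ (by positivity)]

/-- A graph of maximum degree `0` has every vertex set independent. [folklore] -/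
theorem isIndepSet_of_maxDegree_le_zero {n : ℕ} (K : SimpleGraph (Fin n)) (hK : K.maxDegree ≤ 0)
    (I : Finset (Fin n)) : K.IsIndepSet (↑I : Set (Fin n)) := by
  intro u _ v _ _ hadj
  have h1 : 0 < K.degree u := (K.degree_pos_iff_exists_adj u).2 ⟨v, hadj⟩
  have h2 := K.degree_le_maxDegree u
  omega

/-- WITHOUT the degree floor `3 ≤ Δ` the crux is FALSE: at `Δ = 0` the threshold formula gives the junk value
`λ_c(0) = 1 < 2`, and max-degree-`0` graphs on `n` vertices all have `Z(2) = 3^n`, so no gap. [folklore] -/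
theorem false_without_degreeFloor :
    ¬ ∀ Δ : ℕ, ∀ lam : ℝ, lamC Δ < lam → ∃ δ : ℝ, 0 < δ ∧ ∀ k : ℕ,
      ∃ (n : ℕ) (G H : SimpleGraph (Fin n)), Witness Δ lam δ k n G H := by
  intro h
  obtain ⟨δ, hδ, hk⟩ := h 0 2 (by rw [lamC_zero]; norm_num)
  obtain ⟨n, G, H, hn, hG, hH, -, hgap⟩ := hk 0
  have hZ : ∀ K : SimpleGraph (Fin n), K.maxDegree ≤ 0 →
      Z K 2 = ∑ I : Finset (Fin n), (2 : ℝ) ^ I.card := fun K hK =>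
    Finset.sum_congr rfl fun I _ => if_pos (isIndepSet_of_maxDegree_le_zero K hK I)
  rw [hZ G hG, hZ H hH] at hgap
  have hpos : 0 < ∑ I : Finset (Fin n), (2 : ℝ) ^ I.card :=
    Finset.sum_pos (fun I _ => by positivity) Finset.univ_nonempty
  have h1 : Real.exp (δ * n) ≤ 1 := by
    by_contra hc
    have := mul_lt_mul_of_pos_right (not_le.1 hc) hpos
    linarith
  have h2 : 1 < Real.exp (δ * n) := Real.one_lt_exp_iff.2 (mul_pos hδ (Nat.cast_pos.2 hn))
  linarith

/-- WITHOUT the threshold hypothesis (all `λ > 0`) the crux contradicts the route's own support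
`DensityContinuityBelow` (stmt-PneNP-2725, BCKL 2013 Remark 1 + Weitz 2006; known in substance): at `Δ = 3`,
`λ = 1 < 4 = λ_c(3)`. [folklore] -/
theorem false_without_threshold_of_densityContinuityBelow
    (hD : Summit.PneNP.PneNP.Theses.PhaseTwins.DensityContinuityBelow) :
    ¬ ∀ Δ : ℕ, 3 ≤ Δ → ∀ lam : ℝ, 0 < lam → ∃ δ : ℝ, 0 < δ ∧ ∀ k : ℕ,
      ∃ (n : ℕ) (G H : SimpleGraph (Fin n)), Witness Δ lam δ k n G H := by
  intro h
  obtain ⟨δ, hδ, hk⟩ := h 3 le_rfl 1 one_pos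
  obtain ⟨k, hk'⟩ := hD 3 le_rfl 1 zero_le_one (by norm_num) (δ / 2) (by positivity)
  obtain ⟨n, G, H, hn, hG, hH, hhom, hgap⟩ := hk k
  have h1 : Z G 1 ≤ Real.exp (δ / 2 * n) * Z H 1 := hk' n G H hG hH hhom
  have hZH := Z_pos H zero_le_one
  have h3 : Real.exp (δ * n) ≤ Real.exp (δ / 2 * n) := le_of_mul_le_mul_right (hgap.trans h1) hZH
  rw [Real.exp_le_exp] at h3
  have hn' : (0 : ℝ) < n := Nat.cast_pos.2 hn
  nlinarith

/-! ### The swapped quantifier form carries no density content -/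

/-- The crux with `∃ δ` and `∀ k` SWAPPED follows at once from the constant-factor support
`ConstantFactorTwinsEverywhere` (stmt-PneNP-2726) with `δ := log 2 / n`: the whole content of the crux is that `δ`
does not depend on `k`. [folklore] -/
theorem swapped_of_constantFactorTwins
    (h : Summit.PneNP.PneNP.Theses.PhaseTwins.ConstantFactorTwinsEverywhere) :
    ∀ Δ : ℕ, 3 ≤ Δ → ∀ lam : ℝ, lamC Δ < lam → ∀ k : ℕ, ∃ δ : ℝ, 0 < δ ∧
      ∃ (n : ℕ) (G H : SimpleGraph (Fin n)), Witness Δ lam δ k n G H := by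
  intro Δ hΔ lam hlam k
  have hlam0 : 0 < lam := (lamC_pos hΔ).trans hlam
  obtain ⟨n, G, H, hn, hG, hH, hhom, hgap⟩ := h Δ hΔ lam hlam0 k
  have hn' : (0 : ℝ) < n := Nat.cast_pos.2 hn
  refine ⟨Real.log 2 / n, div_pos (Real.log_pos one_lt_two) hn', n, G, H, hn, hG, hH, hhom, ?_⟩
  have : Real.exp (Real.log 2 / n * n) = 2 := by
    rw [div_mul_cancel₀ _ hn'.ne', Real.exp_log two_pos]
  show Real.exp (Real.log 2 / n * n) * Z H lam ≤ Z G lam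
  rw [this]
  exact hgap

/-! ### The exact shape of a refutation: density continuity at ONE point above `λ_c` -/

/-- On `Fin 0` every hard-core sum is `1` (only `I = ∅`). [folklore] -/
theorem Z_fin_zero (G : SimpleGraph (Fin 0)) (lam : ℝ) : Z G lam = 1 := by
  unfold Z
  rw [Fintype.sum_eq_single (∅ : Finset (Fin 0)) (fun I hI => (hI (Finset.eq_empty_of_isEmpty I)).elim)]
  simp [SimpleGraph.isIndepSet_iff, Set.Pairwise]

/-- **Shape of a refutation.** `¬ MacroscopicTwinsAbove` is EQUIVALENT to density continuity of the hard-core free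
energy with respect to the `C^k`-type at some single point `(Δ ≥ 3, λ > λ_c(Δ))` (literally the conclusion shape of
the support `DensityContinuityBelow`, stmt-PneNP-2725, at one activity): a kill is exactly an extension of
`DensityContinuityBelow` to one activity above the uniqueness threshold (a "second threshold" theorem), nothing
less. [folklore] -/
theorem not_crux_iff_densityContinuityAt :
    ¬ Summit.PneNP.PneNP.Theses.PhaseTwins.MacroscopicTwinsAbove ↔
      ∃ Δ : ℕ, 3 ≤ Δ ∧ ∃ lam : ℝ, lamC Δ < lam ∧
        ∀ δ : ℝ, 0 < δ → ∃ k : ℕ, ∀ (n : ℕ) (G H : SimpleGraph (Fin n)), G.maxDegree ≤ Δ → H.maxDegree ≤ Δ →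
          HomIndist k G H → Z G lam ≤ Real.exp (δ * n) * Z H lam := by
  rw [crux_iff]
  constructor
  · intro h
    by_contra hc
    apply h
    intro Δ hΔ lam hlam
    by_contra hδ
    apply hc
    refine ⟨Δ, hΔ, lam, hlam, fun δ hδpos => ?_⟩
    -- no `δ` works for the crux at `(Δ, λ)`; in particular not this one
    have hk : ∃ k : ℕ, ∀ (n : ℕ) (G H : SimpleGraph (Fin n)), ¬ Witness Δ lam δ k n G H := by
      by_contra hk
      apply hδ
      refine ⟨δ, hδpos, fun k => ?_⟩
      by_contra hw
      apply hk
      refine ⟨k, fun n G H hW => hw ⟨n, G, H, hW⟩⟩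
    obtain ⟨k, hk⟩ := hk
    refine ⟨k, fun n G H hG hH hhom => ?_⟩
    rcases Nat.eq_zero_or_pos n with rfl | hn
    · rw [Z_fin_zero, Z_fin_zero]
      simp
    · have hw := hk n G H
      unfold Witness at hw
      have : ¬ Real.exp (δ * n) * Z H lam ≤ Z G lam := fun hle => hw ⟨hn, hG, hH, hhom, hle⟩
      exact (not_le.1 this).le
  · rintro ⟨Δ, hΔ, lam, hlam, hcont⟩ h
    obtain ⟨δ, hδ, hk⟩ := h Δ hΔ lam hlam
    obtain ⟨k, hk'⟩ := hcont (δ / 2) (by positivity)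
    obtain ⟨n, G, H, hn, hG, hH, hhom, hgap⟩ := hk k
    have hlam0 : 0 ≤ lam := ((lamC_pos hΔ).trans hlam).le
    have h1 := hk' n G H hG hH hhom
    have hZH := Z_pos H hlam0
    have h3 : Real.exp (δ * n) ≤ Real.exp (δ / 2 * n) :=
      le_of_mul_le_mul_right (hgap.trans h1) hZH
    rw [Real.exp_le_exp] at h3
    have hn' : (0 : ℝ) < n := Nat.cast_pos.2 hn
    nlinarith

/-- In particular the route's support `DensityContinuityBelow` (all `λ < λ_c`) and the crux (all `λ > λ_c`) are the
two halves of a DICHOTOMY exactly at `λ_c(Δ)`; the crux leaves the point `λ = λ_c(Δ)` itself unclaimed.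
[folklore] -/
theorem densityContinuityAt_of_below (hD : Summit.PneNP.PneNP.Theses.PhaseTwins.DensityContinuityBelow)
    {Δ : ℕ} (hΔ : 3 ≤ Δ) {lam : ℝ} (h0 : 0 ≤ lam) (hlt : lam < lamC Δ) :
    ∀ δ : ℝ, 0 < δ → ∃ k : ℕ, ∀ (n : ℕ) (G H : SimpleGraph (Fin n)), G.maxDegree ≤ Δ → H.maxDegree ≤ Δ →
      HomIndist k G H → Z G lam ≤ Real.exp (δ * n) * Z H lam :=
  fun δ hδ => hD Δ hΔ lam h0 hlt δ hδ

end Summit.PneNP.PneNP.Theorems.MacroscopicTwinsAbove.Negative
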